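import Summits.QuantumFields.BalabanUV.Beta.GAN24.ExponentialChartHessianForm

/-!
# `BalabanUV.Beta.GAN24.ExponentialChartHessianKernels` — binder row G-an2-4 ∕ (CONV-C), route R7 «TWO CURRENCIES», PART 258: THE INFINITE-VOLUME LIMIT KERNELS OF THE ONE-LOOP HESSIAN ARE
# SYMMETRIC AND BILINEAR IN THE BACKGROUNDS, AND THE DIAGONAL LIMIT KERNEL IS PART 247's `N = 2` LIMIT KERNEL.  PART 254 gives, for volume-indexed real Lipschitz `A_t, B_t`, kernels
# `Π_k(A, B)` on `ℤ^d` with `IsInfiniteVolumeLimit` (and UniformDecay ∕ StepRate ∕ KernelInputs ∕ the secondMoment rate); PART 257 gives the finite-volume identities `H(A, B) = H(B, A)`,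
# `H(A₁ + A₂, B) = H(A₁, B) + H(A₂, B)`, `H(cA, B) = c·H(A, B)` (and in the second argument), `H(A, A) = ∂²_s|₀`.  Limits in `ℝ` are unique, so ANY infinite-volume limit kernels of these
# families satisfy `Π(A, B) = Π(B, A)`, `Π(A₁ + A₂, B) = Π(A₁, B) + Π(A₂, B)`, `Π(cA, B) = c·Π(A, B)`, the same in `B`, and `Π(A, A) = Π^{(2)}(A)` (the limit kernel of PART 247's `N = 2`
# family) — pointwise on `ℤ^d`, every level `k`: the vacuum-polarisation tensor's kernel is a symmetric bilinear function of the background families (unit b2b-balaban-gan24-p3, gen 66; v1;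
# generator `HOME/b2b-balaban-gan24-p3/gen66/records/gen/gen258.py`)

NOT IN PRINT; OUR PROOF ([folklore] bookkeeping BY NAME over PART 257 (`hessian_symm ∕ _diag ∕ _add_left ∕ _smul_left ∕ _add_right ∕ _smul_right`), Mathlib's `tendsto_nhds_unique`,
`Filter.Tendsto.congr ∕ add ∕ const_mul`, `Matrix.add_apply ∕ smul_apply`, `Complex.add_re ∕ re_ofReal_mul`; [Balaban1987RG1] (1.20)–(1.22) p. 264 LOCATE the shapes; nothing printed is a
hypothesis).
HONEST FRAMING (cell contract, verbatim): «discharging `BetaPertH` makes Bałaban's UV stability UNCONDITIONAL — a real constructive-QFT result; it is NOT the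
continuum limit and NOT the Clay problem.»  HONEST DEPENDENCY (verbatim): «continuum YM on T⁴ ⇐ BetaPertH ∧ nine spine estimates (0/9 proved); BetaPertH ⇐
(D1) ∧ (D4) ∧ CAP+tail; G-an2-4 gates asym, D1 and NE2/3/4.»

WHAT THIS FILE PROVES (0 sorry, 0 `def`; even cubic volumes `2(t+1)`, level `k`, `Π` any `IsInfiniteVolumeLimit` kernels of the displayed families):
* **`hessianKernel_symm`**, **`hessianKernel_add_left`**, **`hessianKernel_smul_left`**, `hessianKernel_add_right`, `hessianKernel_smul_right`, **`hessianKernel_diag`**.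
WHAT IT DOES NOT DO: existence of the kernels (PART 254 ∕ PART 247 under the Lipschitz + EL₁ hypotheses); the secondMoment ∕ `limKernelOf` consequences (linear maps of the kernels, on ask).
SUPPLIER work; NEVER «G-an2-4 closed»; NOT (CONV-C), NOT D1, NOT `BetaPertH`, NOT continuum, NOT Clay.  Records: `HOME/b2b-balaban-gan24-p3/gen66/README.md`.
-/

noncomputable section

open scoped BigOperators ComplexConjugate Matrix Matrix.Norms.L2Operator
open Filter Topology

namespace Summit.QuantumFields.BalabanUV.Beta.GAN24.ExponentialChartHessianKernels

open Literature.MathematicalPhysics.QuantumFieldTheory.Balaban1983to89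
open Literature.MathematicalPhysics.QuantumFieldTheory.Balaban1983to89.B5Prop11Plancherel (Tor fine)
open Literature.MathematicalPhysics.QuantumFieldTheory.Balaban1983to89.B5G183RateUnitTower (lev)
open Literature.MathematicalPhysics.QuantumFieldTheory.Balaban1983to89.Beta (Site IsInfiniteVolumeLimit)
open Literature.MathematicalPhysics.QuantumFieldTheory.Balaban1983to89.Beta.FreeLegDictionary (cubic)
open Literature.MathematicalPhysics.QuantumFieldTheory.Balaban1983to89.Beta.BlockKernelVolumeSockets (evenPeriod)
open Summit.QuantumFields.BalabanUV.T4Continuum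
open Summit.QuantumFields.BalabanUV.T4Continuum.CovariantAveragingTower (avgTow)
open Summit.QuantumFields.BalabanUV.T4Continuum.BalabanAveragedTowerUnit (idx QBlev)
open Summit.QuantumFields.BalabanUV.T4Continuum.BalabanAveragedCoerciveTower (unitIdx)
open Summit.QuantumFields.BalabanUV.T4Continuum.KingPairingPlantedLaw (calDalev)
open Summit.QuantumFields.BalabanUV.T4Continuum.AbelianCovariantLaplacian (covPert)
open Summit.QuantumFields.BalabanUV.Beta.GAN24.ExponentialChartHessianForm (hessian_symm hessian_diag hessian_add_left hessian_smul_left hessian_add_right hessian_smul_right)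

variable {d : ℕ} (L : ℕ) [NeZero L] (a : ℝ) (ha : 0 < a)

/-- **`hessianKernel_symm` — THE LIMIT KERNEL OF THE HESSIAN IS SYMMETRIC IN THE BACKGROUNDS**: if `Π` and `Π′` are infinite-volume limit kernels of the Hessian families of `(A,
      B)` and
`(B, A)` at level `k`, then `Π = Π′` pointwise (PART 257's `hessian_symm` volume by volume; limits are unique). [our proof] -/
theorem hessianKernel_symm {A B : (t : ℕ) → (k : ℕ) → Fin d → (idx L (cubic d (evenPeriod t)) k → ℝ)} (k : ℕ) {P P' : B12Beta.Kernel d}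
    (h : IsInfiniteVolumeLimit evenPeriod
      (fun t μ' ν' (z : Site d (evenPeriod t)) =>
          ((deriv (fun r : ℝ => deriv (fun s : ℝ => (avgTow (QBlev L (cubic d (evenPeriod t))) ((L : ℝ) ^ d)
          (fun k' => (calDalev L (cubic d (evenPeriod t)) a ha k' + covPert L (cubic d (evenPeriod t)) (fun k'' ν' (x' : idx L (cubic d (evenPeriod t)) k'') => Complex.exp
                ((Complex.I * ((A t k'' ν' x' : ℝ) : ℂ) / ((lev L k'' : ℕ) : ℂ)) * ((s : ℝ) : ℂ) + (Complex.I * ((B t k'' ν' x' : ℝ) : ℂ) / ((lev L k'' : ℕ) : ℂ)) * ((r : ℝ) :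
                ℂ))) k')⁻¹) k)⁻¹) 0) 0)
            ((unitIdx L (cubic d (evenPeriod t))).symm (z, μ')) ((unitIdx L (cubic d (evenPeriod t))).symm (0, ν'))).re) P)
    (h' : IsInfiniteVolumeLimit evenPeriod
      (fun t μ' ν' (z : Site d (evenPeriod t)) =>
          ((deriv (fun r : ℝ => deriv (fun s : ℝ => (avgTow (QBlev L (cubic d (evenPeriod t))) ((L : ℝ) ^ d)
          (fun k' => (calDalev L (cubic d (evenPeriod t)) a ha k' + covPert L (cubic d (evenPeriod t)) (fun k'' ν' (x' : idx L (cubic d (evenPeriod t)) k'') => Complex.exp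
                ((Complex.I * ((B t k'' ν' x' : ℝ) : ℂ) / ((lev L k'' : ℕ) : ℂ)) * ((s : ℝ) : ℂ) + (Complex.I * ((A t k'' ν' x' : ℝ) : ℂ) / ((lev L k'' : ℕ) : ℂ)) * ((r : ℝ) :
                ℂ))) k')⁻¹) k)⁻¹) 0) 0)
            ((unitIdx L (cubic d (evenPeriod t))).symm (z, μ')) ((unitIdx L (cubic d (evenPeriod t))).symm (0, ν'))).re) P') :
    ∀ μ ν (x : Fin d → ℤ), P μ ν x = P' μ ν x := by
  intro μ ν x
  refine tendsto_nhds_unique (h μ ν x) ((h' μ ν x).congr fun t => ?_)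
  dsimp only
  rw [hessian_symm L (cubic d (evenPeriod t)) a ha (A t) (B t) k]

/-- **`hessianKernel_add_left` — THE LIMIT KERNEL IS ADDITIVE IN THE FIRST BACKGROUND**: limit kernels `Π₁, Π₂, Π₁₂` of the Hessian families of `(A₁, B)`, `(A₂, B)`, `(A₁ + A₂,
      B)` at level `k`
satisfy `Π₁₂ = Π₁ + Π₂` pointwise (PART 257's `hessian_add_left`; `Tendsto.add`; uniqueness). [our proof] -/
theorem hessianKernel_add_left {A₁ A₂ B : (t : ℕ) → (k : ℕ) → Fin d → (idx L (cubic d (evenPeriod t)) k → ℝ)} (k : ℕ) {P₁ P₂ P₁₂ : B12Beta.Kernel d}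
    (h₁ : IsInfiniteVolumeLimit evenPeriod
      (fun t μ' ν' (z : Site d (evenPeriod t)) =>
          ((deriv (fun r : ℝ => deriv (fun s : ℝ => (avgTow (QBlev L (cubic d (evenPeriod t))) ((L : ℝ) ^ d)
          (fun k' => (calDalev L (cubic d (evenPeriod t)) a ha k' + covPert L (cubic d (evenPeriod t)) (fun k'' ν' (x' : idx L (cubic d (evenPeriod t)) k'') => Complex.exp
                ((Complex.I * ((A₁ t k'' ν' x' : ℝ) : ℂ) / ((lev L k'' : ℕ) : ℂ)) * ((s : ℝ) : ℂ) + (Complex.I * ((B t k'' ν' x' : ℝ) : ℂ) / ((lev L k'' : ℕ) : ℂ)) * ((r : ℝ) :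
                ℂ))) k')⁻¹) k)⁻¹) 0) 0)
            ((unitIdx L (cubic d (evenPeriod t))).symm (z, μ')) ((unitIdx L (cubic d (evenPeriod t))).symm (0, ν'))).re) P₁)
    (h₂ : IsInfiniteVolumeLimit evenPeriod
      (fun t μ' ν' (z : Site d (evenPeriod t)) =>
          ((deriv (fun r : ℝ => deriv (fun s : ℝ => (avgTow (QBlev L (cubic d (evenPeriod t))) ((L : ℝ) ^ d)
          (fun k' => (calDalev L (cubic d (evenPeriod t)) a ha k' + covPert L (cubic d (evenPeriod t)) (fun k'' ν' (x' : idx L (cubic d (evenPeriod t)) k'') => Complex.exp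
                ((Complex.I * ((A₂ t k'' ν' x' : ℝ) : ℂ) / ((lev L k'' : ℕ) : ℂ)) * ((s : ℝ) : ℂ) + (Complex.I * ((B t k'' ν' x' : ℝ) : ℂ) / ((lev L k'' : ℕ) : ℂ)) * ((r : ℝ) :
                ℂ))) k')⁻¹) k)⁻¹) 0) 0)
            ((unitIdx L (cubic d (evenPeriod t))).symm (z, μ')) ((unitIdx L (cubic d (evenPeriod t))).symm (0, ν'))).re) P₂)
    (h₁₂ : IsInfiniteVolumeLimit evenPeriod
      (fun t μ' ν' (z : Site d (evenPeriod t)) =>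
          ((deriv (fun r : ℝ => deriv (fun s : ℝ => (avgTow (QBlev L (cubic d (evenPeriod t))) ((L : ℝ) ^ d)
          (fun k' => (calDalev L (cubic d (evenPeriod t)) a ha k' + covPert L (cubic d (evenPeriod t)) (fun k'' ν' (x' : idx L (cubic d (evenPeriod t)) k'') => Complex.exp
                ((Complex.I * ((A₁ t k'' ν' x' + A₂ t k'' ν' x' : ℝ) : ℂ) / ((lev L k'' : ℕ) : ℂ)) * ((s : ℝ) : ℂ) + (Complex.I * ((B t k'' ν' x' : ℝ) : ℂ) / ((lev L k'' : ℕ) :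
                ℂ)) * ((r : ℝ) : ℂ))) k')⁻¹) k)⁻¹) 0) 0)
            ((unitIdx L (cubic d (evenPeriod t))).symm (z, μ')) ((unitIdx L (cubic d (evenPeriod t))).symm (0, ν'))).re) P₁₂) :
    ∀ μ ν (x : Fin d → ℤ), P₁₂ μ ν x = P₁ μ ν x + P₂ μ ν x := by
  intro μ ν x
  refine tendsto_nhds_unique (h₁₂ μ ν x) (((h₁ μ ν x).add (h₂ μ ν x)).congr fun t => ?_)
  dsimp only
  rw [hessian_add_left L (cubic d (evenPeriod t)) a ha (A₁ t) (A₂ t) (B t) k, Matrix.add_apply, Complex.add_re]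

/-- **`hessianKernel_smul_left` — THE LIMIT KERNEL IS HOMOGENEOUS IN THE FIRST BACKGROUND** (real `c`): `Π(cA, B) = c·Π(A, B)` pointwise. [our proof] -/
theorem hessianKernel_smul_left (c : ℝ) {A B : (t : ℕ) → (k : ℕ) → Fin d → (idx L (cubic d (evenPeriod t)) k → ℝ)} (k : ℕ) {P Pc : B12Beta.Kernel d}
    (h : IsInfiniteVolumeLimit evenPeriod
      (fun t μ' ν' (z : Site d (evenPeriod t)) =>
          ((deriv (fun r : ℝ => deriv (fun s : ℝ => (avgTow (QBlev L (cubic d (evenPeriod t))) ((L : ℝ) ^ d)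
          (fun k' => (calDalev L (cubic d (evenPeriod t)) a ha k' + covPert L (cubic d (evenPeriod t)) (fun k'' ν' (x' : idx L (cubic d (evenPeriod t)) k'') => Complex.exp
                ((Complex.I * ((A t k'' ν' x' : ℝ) : ℂ) / ((lev L k'' : ℕ) : ℂ)) * ((s : ℝ) : ℂ) + (Complex.I * ((B t k'' ν' x' : ℝ) : ℂ) / ((lev L k'' : ℕ) : ℂ)) * ((r : ℝ) :
                ℂ))) k')⁻¹) k)⁻¹) 0) 0)
            ((unitIdx L (cubic d (evenPeriod t))).symm (z, μ')) ((unitIdx L (cubic d (evenPeriod t))).symm (0, ν'))).re) P)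
    (hc : IsInfiniteVolumeLimit evenPeriod
      (fun t μ' ν' (z : Site d (evenPeriod t)) =>
          ((deriv (fun r : ℝ => deriv (fun s : ℝ => (avgTow (QBlev L (cubic d (evenPeriod t))) ((L : ℝ) ^ d)
          (fun k' => (calDalev L (cubic d (evenPeriod t)) a ha k' + covPert L (cubic d (evenPeriod t)) (fun k'' ν' (x' : idx L (cubic d (evenPeriod t)) k'') => Complex.exp
                ((Complex.I * ((c * A t k'' ν' x' : ℝ) : ℂ) / ((lev L k'' : ℕ) : ℂ)) * ((s : ℝ) : ℂ) + (Complex.I * ((B t k'' ν' x' : ℝ) : ℂ) / ((lev L k'' : ℕ) : ℂ)) * ((r : ℝ) :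
                ℂ))) k')⁻¹) k)⁻¹) 0) 0)
            ((unitIdx L (cubic d (evenPeriod t))).symm (z, μ')) ((unitIdx L (cubic d (evenPeriod t))).symm (0, ν'))).re) Pc) :
    ∀ μ ν (x : Fin d → ℤ), Pc μ ν x = c * P μ ν x := by
  intro μ ν x
  refine tendsto_nhds_unique (hc μ ν x) (((h μ ν x).const_mul c).congr fun t => ?_)
  dsimp only
  rw [hessian_smul_left L (cubic d (evenPeriod t)) a ha c (A t) (B t) k, Matrix.smul_apply, smul_eq_mul, Complex.re_ofReal_mul]

/-- `hessianKernel_add_right` — additivity in the second background (PART 257's `hessian_add_right`). [our proof] -/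
theorem hessianKernel_add_right {A B₁ B₂ : (t : ℕ) → (k : ℕ) → Fin d → (idx L (cubic d (evenPeriod t)) k → ℝ)} (k : ℕ) {P₁ P₂ P₁₂ : B12Beta.Kernel d}
    (h₁ : IsInfiniteVolumeLimit evenPeriod
      (fun t μ' ν' (z : Site d (evenPeriod t)) =>
          ((deriv (fun r : ℝ => deriv (fun s : ℝ => (avgTow (QBlev L (cubic d (evenPeriod t))) ((L : ℝ) ^ d)
          (fun k' => (calDalev L (cubic d (evenPeriod t)) a ha k' + covPert L (cubic d (evenPeriod t)) (fun k'' ν' (x' : idx L (cubic d (evenPeriod t)) k'') => Complex.exp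
                ((Complex.I * ((A t k'' ν' x' : ℝ) : ℂ) / ((lev L k'' : ℕ) : ℂ)) * ((s : ℝ) : ℂ) + (Complex.I * ((B₁ t k'' ν' x' : ℝ) : ℂ) / ((lev L k'' : ℕ) : ℂ)) * ((r : ℝ) :
                ℂ))) k')⁻¹) k)⁻¹) 0) 0)
            ((unitIdx L (cubic d (evenPeriod t))).symm (z, μ')) ((unitIdx L (cubic d (evenPeriod t))).symm (0, ν'))).re) P₁)
    (h₂ : IsInfiniteVolumeLimit evenPeriod
      (fun t μ' ν' (z : Site d (evenPeriod t)) =>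
          ((deriv (fun r : ℝ => deriv (fun s : ℝ => (avgTow (QBlev L (cubic d (evenPeriod t))) ((L : ℝ) ^ d)
          (fun k' => (calDalev L (cubic d (evenPeriod t)) a ha k' + covPert L (cubic d (evenPeriod t)) (fun k'' ν' (x' : idx L (cubic d (evenPeriod t)) k'') => Complex.exp
                ((Complex.I * ((A t k'' ν' x' : ℝ) : ℂ) / ((lev L k'' : ℕ) : ℂ)) * ((s : ℝ) : ℂ) + (Complex.I * ((B₂ t k'' ν' x' : ℝ) : ℂ) / ((lev L k'' : ℕ) : ℂ)) * ((r : ℝ) :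
                ℂ))) k')⁻¹) k)⁻¹) 0) 0)
            ((unitIdx L (cubic d (evenPeriod t))).symm (z, μ')) ((unitIdx L (cubic d (evenPeriod t))).symm (0, ν'))).re) P₂)
    (h₁₂ : IsInfiniteVolumeLimit evenPeriod
      (fun t μ' ν' (z : Site d (evenPeriod t)) =>
          ((deriv (fun r : ℝ => deriv (fun s : ℝ => (avgTow (QBlev L (cubic d (evenPeriod t))) ((L : ℝ) ^ d)
          (fun k' => (calDalev L (cubic d (evenPeriod t)) a ha k' + covPert L (cubic d (evenPeriod t)) (fun k'' ν' (x' : idx L (cubic d (evenPeriod t)) k'') => Complex.exp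
                ((Complex.I * ((A t k'' ν' x' : ℝ) : ℂ) / ((lev L k'' : ℕ) : ℂ)) * ((s : ℝ) : ℂ) + (Complex.I * ((B₁ t k'' ν' x' + B₂ t k'' ν' x' : ℝ) : ℂ) / ((lev L k'' : ℕ) :
                ℂ)) * ((r : ℝ) : ℂ))) k')⁻¹) k)⁻¹) 0) 0)
            ((unitIdx L (cubic d (evenPeriod t))).symm (z, μ')) ((unitIdx L (cubic d (evenPeriod t))).symm (0, ν'))).re) P₁₂) :
    ∀ μ ν (x : Fin d → ℤ), P₁₂ μ ν x = P₁ μ ν x + P₂ μ ν x := by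
  intro μ ν x
  refine tendsto_nhds_unique (h₁₂ μ ν x) (((h₁ μ ν x).add (h₂ μ ν x)).congr fun t => ?_)
  dsimp only
  rw [hessian_add_right L (cubic d (evenPeriod t)) a ha (A t) (B₁ t) (B₂ t) k, Matrix.add_apply, Complex.add_re]

/-- `hessianKernel_smul_right` — homogeneity in the second background (PART 257's `hessian_smul_right`), real `c`. [our proof] -/
theorem hessianKernel_smul_right (c : ℝ) {A B : (t : ℕ) → (k : ℕ) → Fin d → (idx L (cubic d (evenPeriod t)) k → ℝ)} (k : ℕ) {P Pc : B12Beta.Kernel d}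
    (h : IsInfiniteVolumeLimit evenPeriod
      (fun t μ' ν' (z : Site d (evenPeriod t)) =>
          ((deriv (fun r : ℝ => deriv (fun s : ℝ => (avgTow (QBlev L (cubic d (evenPeriod t))) ((L : ℝ) ^ d)
          (fun k' => (calDalev L (cubic d (evenPeriod t)) a ha k' + covPert L (cubic d (evenPeriod t)) (fun k'' ν' (x' : idx L (cubic d (evenPeriod t)) k'') => Complex.exp
                ((Complex.I * ((A t k'' ν' x' : ℝ) : ℂ) / ((lev L k'' : ℕ) : ℂ)) * ((s : ℝ) : ℂ) + (Complex.I * ((B t k'' ν' x' : ℝ) : ℂ) / ((lev L k'' : ℕ) : ℂ)) * ((r : ℝ) :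
                ℂ))) k')⁻¹) k)⁻¹) 0) 0)
            ((unitIdx L (cubic d (evenPeriod t))).symm (z, μ')) ((unitIdx L (cubic d (evenPeriod t))).symm (0, ν'))).re) P)
    (hc : IsInfiniteVolumeLimit evenPeriod
      (fun t μ' ν' (z : Site d (evenPeriod t)) =>
          ((deriv (fun r : ℝ => deriv (fun s : ℝ => (avgTow (QBlev L (cubic d (evenPeriod t))) ((L : ℝ) ^ d)
          (fun k' => (calDalev L (cubic d (evenPeriod t)) a ha k' + covPert L (cubic d (evenPeriod t)) (fun k'' ν' (x' : idx L (cubic d (evenPeriod t)) k'') => Complex.exp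
                ((Complex.I * ((A t k'' ν' x' : ℝ) : ℂ) / ((lev L k'' : ℕ) : ℂ)) * ((s : ℝ) : ℂ) + (Complex.I * ((c * B t k'' ν' x' : ℝ) : ℂ) / ((lev L k'' : ℕ) : ℂ)) * ((r : ℝ) :
                ℂ))) k')⁻¹) k)⁻¹) 0) 0)
            ((unitIdx L (cubic d (evenPeriod t))).symm (z, μ')) ((unitIdx L (cubic d (evenPeriod t))).symm (0, ν'))).re) Pc) :
    ∀ μ ν (x : Fin d → ℤ), Pc μ ν x = c * P μ ν x := by
  intro μ ν x
  refine tendsto_nhds_unique (hc μ ν x) (((h μ ν x).const_mul c).congr fun t => ?_)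
  dsimp only
  rw [hessian_smul_right L (cubic d (evenPeriod t)) a ha c (A t) (B t) k, Matrix.smul_apply, smul_eq_mul, Complex.re_ofReal_mul]

/-- **`hessianKernel_diag` — THE DIAGONAL LIMIT KERNEL OF THE HESSIAN IS PART 247's `N = 2` LIMIT KERNEL**: if `Π` is a limit kernel of the Hessian family of `(A, A)` and `Π⁽²⁾` a
      limit kernel of
the family `∂²_s|₀[(L^{dk}Q_k(Δ_a^{(k)} + covPert e^{isηA_t} k)⁻¹Q_kᴴ)⁻¹]` (PART 247's `conv_iteratedDeriv_invCov_expChart_of_tendsto` at `N = 2`), then `Π = Π⁽²⁾` pointwise (PART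
      257's
`hessian_diag`; uniqueness). [our proof] -/
theorem hessianKernel_diag {A : (t : ℕ) → (k : ℕ) → Fin d → (idx L (cubic d (evenPeriod t)) k → ℝ)} (k : ℕ) {P P2 : B12Beta.Kernel d}
    (h : IsInfiniteVolumeLimit evenPeriod
      (fun t μ' ν' (z : Site d (evenPeriod t)) =>
          ((deriv (fun r : ℝ => deriv (fun s : ℝ => (avgTow (QBlev L (cubic d (evenPeriod t))) ((L : ℝ) ^ d)
          (fun k' => (calDalev L (cubic d (evenPeriod t)) a ha k' + covPert L (cubic d (evenPeriod t)) (fun k'' ν' (x' : idx L (cubic d (evenPeriod t)) k'') => Complex.exp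
                ((Complex.I * ((A t k'' ν' x' : ℝ) : ℂ) / ((lev L k'' : ℕ) : ℂ)) * ((s : ℝ) : ℂ) + (Complex.I * ((A t k'' ν' x' : ℝ) : ℂ) / ((lev L k'' : ℕ) : ℂ)) * ((r : ℝ) :
                ℂ))) k')⁻¹) k)⁻¹) 0) 0)
            ((unitIdx L (cubic d (evenPeriod t))).symm (z, μ')) ((unitIdx L (cubic d (evenPeriod t))).symm (0, ν'))).re) P)
    (h2 : IsInfiniteVolumeLimit evenPeriod
      (fun t μ' ν' (z : Site d (evenPeriod t)) =>
          ((iteratedDeriv 2 (fun s : ℝ => (avgTow (QBlev L (cubic d (evenPeriod t))) ((L : ℝ) ^ d)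
          (fun k' => (calDalev L (cubic d (evenPeriod t)) a ha k' + covPert L (cubic d (evenPeriod t)) (fun k'' ν' (x' : idx L (cubic d (evenPeriod t)) k'') => Complex.exp
                ((Complex.I * ((A t k'' ν' x' : ℝ) : ℂ) / ((lev L k'' : ℕ) : ℂ)) * ((s : ℝ) : ℂ))) k')⁻¹) k)⁻¹) 0)
            ((unitIdx L (cubic d (evenPeriod t))).symm (z, μ')) ((unitIdx L (cubic d (evenPeriod t))).symm (0, ν'))).re) P2) :
    ∀ μ ν (x : Fin d → ℤ), P μ ν x = P2 μ ν x := by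
  intro μ ν x
  refine tendsto_nhds_unique (h μ ν x) ((h2 μ ν x).congr fun t => ?_)
  dsimp only
  rw [hessian_diag L (cubic d (evenPeriod t)) a ha (A t) k]

end Summit.QuantumFields.BalabanUV.Beta.GAN24.ExponentialChartHessianKernels

end
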